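import Summits.ValiantsHypothesis.ValiantsHypothesis.Theorems.DepthWindowSparseTwoLevel
import Summits.ValiantsHypothesis.ValiantsHypothesis.Theorems.DepthWindowHomBlocks
import Literature.Computability.AlgebraicComplexity.CircuitGateSemantics
import Mathlib.RingTheory.MvPolynomial.WeightedHomogeneous
import HarnessLib

/-!
# Route `DepthWindow`, g8 — PRESENTED jump layers (first piece of the fused form (iv′))

First kernel piece of the FUSED variant of piece (iv) that the `(2,3)` sliver needs (lens-4 NODE-v8
§12, SPEC (iv′) in v8/SliverSpec.lean).  When the weight-`0` components of the factors are scalars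
`[U_l]_0 = C (u0 l)` and every positive-weight component comes with a `Σ Π` PRESENTATION
`[U_l]_ω = Σ_{s<S} C (coef l ω s) · ∏_{j<m} op l ω s j` over operands `op` (refs below `n`, depth
`≤ D₀`, each row weighted homogeneous of weight `ω`), then every entry of the jump matrix, of the
identity layers and hence of the padded layers is itself PRESENTED:
`entry x y = Σ_{s<S} C (layerCoef … s) · ∏_{j<m} (layerOp … s j).eval V` with uniform row length `m`,
rows of weight `y₁ - x₁` (dead rows are all-zero), operands of depth `≤ D₀`
(`padLayers_eq_sum_present`, `prod_layerOp_isWeightedHomogeneous`, `layerOp_refsBelow`,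
`layerOp_depthIn`).  Distributing the block products over these presentations (next piece) puts the
fused leaves at depth `D₀` instead of `D₀ + 1`.  Pure bookkeeping; nothing here bears on `VP ≠ VNP`.

[cite: LimayeSrinivasanTavenas2025, Lemma 11] [cite: Burgisser2000, Def. 2.1]
-/

set_option linter.dupNamespace false

namespace Summit.ValiantsHypothesis.ValiantsHypothesis.Theorems.DepthWindow

open Finset MvPolynomial Literature.Computability.AlgebraicComplexity ArithCircuit

variable {k : Type*} [CommRing k] {τ : Type*}

/-- Coefficient row of the presented jump entry `x → y`. -/
noncomputable def jumpCoef (d t S : ℕ) (u0 : ℕ → k) (coef : ℕ → ℕ → Fin S → k)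
    (x y : Fin (d + 1) × Fin (t + 1)) (s : Fin S) : k :=
  if (x.2 : ℕ) < y.2 ∧ (x.1 : ℕ) < y.1 then
    (∏ l ∈ Ico (x.2 : ℕ) ((y.2 : ℕ) - 1), u0 l) * coef ((y.2 : ℕ) - 1) ((y.1 : ℕ) - x.1) s
  else 0

/-- Operand rows of the presented jump entry `x → y` (dead rows all-zero). -/
def jumpOp (d t S m : ℕ) (op : ℕ → ℕ → Fin S → Fin m → Operand k τ)
    (x y : Fin (d + 1) × Fin (t + 1)) (s : Fin S) (j : Fin m) : Operand k τ :=
  if (x.2 : ℕ) < y.2 ∧ (x.1 : ℕ) < y.1 then op ((y.2 : ℕ) - 1) ((y.1 : ℕ) - x.1) s j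
  else Operand.const 0

/-- Coefficient row of the presented identity entry. -/
def idCoef (d t S : ℕ) (x y : Fin (d + 1) × Fin (t + 1)) (s : Fin S) : k :=
  if x = y ∧ (s : ℕ) = 0 then 1 else 0

/-- Operand rows of the presented identity entry (row `0` all-one when `x = y`, else dead). -/
def idOp (d t S m : ℕ) (x y : Fin (d + 1) × Fin (t + 1)) (s : Fin S) (_j : Fin m) : Operand k τ :=
  if x = y ∧ (s : ℕ) = 0 then Operand.const 1 else Operand.const 0

/-- Coefficient rows of the presented padded layer `i` (jump layer if `i < κ`, identity otherwise). -/
noncomputable def layerCoef (d t S : ℕ) (u0 : ℕ → k) (coef : ℕ → ℕ → Fin S → k) (κ i : ℕ)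
    (x y : Fin (d + 1) × Fin (t + 1)) (s : Fin S) : k :=
  if i < κ then jumpCoef d t S u0 coef x y s else idCoef d t S x y s

/-- Operand rows of the presented padded layer `i`. -/
def layerOp (d t S m : ℕ) (op : ℕ → ℕ → Fin S → Fin m → Operand k τ) (κ i : ℕ)
    (x y : Fin (d + 1) × Fin (t + 1)) (s : Fin S) (j : Fin m) : Operand k τ :=
  if i < κ then jumpOp d t S m op x y s j else idOp d t S m x y s j

section Present

variable (w : τ → ℕ) (d t S m : ℕ) (U : ℕ → MvPolynomial τ k) (u0 : ℕ → k)
  (coef : ℕ → ℕ → Fin S → k) (op : ℕ → ℕ → Fin S → Fin m → Operand k τ)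
  (V : List (MvPolynomial τ k)) (D : List ℕ) (n D₀ : ℕ)

/-- **Presented jump entries.** -/
theorem jumpMat_eq_sum_present
    (h0 : ∀ l, l < t → weightedHomogeneousComponent w 0 (U l) = C (u0 l))
    (hpres : ∀ l ω, l < t → 1 ≤ ω → ω ≤ d →
      ∑ s : Fin S, C (coef l ω s) * ∏ j : Fin m, (op l ω s j).eval V =
        weightedHomogeneousComponent w ω (U l))
    (x y : Fin (d + 1) × Fin (t + 1)) :
    jumpMat w d t U x y =
      ∑ s : Fin S, C (jumpCoef d t S u0 coef x y s) * ∏ j : Fin m, (jumpOp d t S m op x y s j).eval V := by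
  rw [jumpMat_apply]
  unfold jumpCoef jumpOp
  have hy1 := y.1.isLt
  have hy2 := y.2.isLt
  by_cases hv : (x.2 : ℕ) < y.2 ∧ (x.1 : ℕ) < y.1
  · simp only [if_pos hv]
    have hl : (y.2 : ℕ) - 1 < t := by omega
    have hIco : ∏ l ∈ Ico (x.2 : ℕ) ((y.2 : ℕ) - 1), weightedHomogeneousComponent w 0 (U l) =
        C (∏ l ∈ Ico (x.2 : ℕ) ((y.2 : ℕ) - 1), u0 l) := by
      rw [map_prod]
      refine Finset.prod_congr rfl fun l hlm => h0 l ?_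
      rw [Finset.mem_Ico] at hlm
      omega
    rw [hIco, ← hpres _ _ hl (by omega) (by omega), Finset.mul_sum]
    refine Finset.sum_congr rfl fun s _ => ?_
    rw [map_mul, mul_assoc]
  · simp only [if_neg hv]
    symm
    refine Finset.sum_eq_zero fun s _ => ?_
    rw [C_0, zero_mul]

/-- **Presented identity entries** (needs a row `0`, i.e. `1 ≤ S`). -/
theorem one_apply_eq_sum_present (hS : 1 ≤ S) (x y : Fin (d + 1) × Fin (t + 1)) :
    (1 : Matrix (Fin (d + 1) × Fin (t + 1)) (Fin (d + 1) × Fin (t + 1)) (MvPolynomial τ k)) x y =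
      ∑ s : Fin S, C (idCoef d t S x y s) * ∏ j : Fin m, (idOp d t S m x y s j).eval V := by
  unfold idCoef idOp
  by_cases hxy : x = y
  · subst hxy
    rw [Matrix.one_apply_eq, Finset.sum_eq_single (⟨0, hS⟩ : Fin S)]
    · have hc : x = x ∧ (((⟨0, hS⟩ : Fin S) : ℕ) = 0) := ⟨rfl, rfl⟩
      rw [if_pos hc, if_pos hc, C_1, one_mul]
      symm
      exact Finset.prod_eq_one fun j _ => by simp only [Operand.eval, C_1]
    · intro s _ hs
      have hs' : ¬ ((s : ℕ) = 0) := fun h => hs (Fin.ext h)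
      simp only [true_and, if_neg hs', C_0, zero_mul]
    · intro h; exact absurd (Finset.mem_univ _) h
  · rw [Matrix.one_apply_ne hxy]
    symm
    refine Finset.sum_eq_zero fun s _ => ?_
    rw [if_neg (fun h => hxy h.1), C_0, zero_mul]

/-- **Presented padded layers.** -/
theorem padLayers_eq_sum_present (hS : 1 ≤ S)
    (h0 : ∀ l, l < t → weightedHomogeneousComponent w 0 (U l) = C (u0 l))
    (hpres : ∀ l ω, l < t → 1 ≤ ω → ω ≤ d →
      ∑ s : Fin S, C (coef l ω s) * ∏ j : Fin m, (op l ω s j).eval V =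
        weightedHomogeneousComponent w ω (U l))
    (κ N : ℕ) (i : Fin N) (x y : Fin (d + 1) × Fin (t + 1)) :
    padLayers (jumpMat w d t U) κ N i x y =
      ∑ s : Fin S, C (layerCoef d t S u0 coef κ i x y s) *
        ∏ j : Fin m, (layerOp d t S m op κ i x y s j).eval V := by
  unfold padLayers layerCoef layerOp
  by_cases hi : (i : ℕ) < κ
  · simp only [if_pos hi]
    exact jumpMat_eq_sum_present w d t S m U u0 coef op V h0 hpres x y
  · simp only [if_neg hi]
    exact one_apply_eq_sum_present d t S m V hS x y

/-- Rows of the presented jump entry have weight `y₁ - x₁` (dead rows vanish; needs `1 ≤ m`). -/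
theorem prod_jumpOp_isWeightedHomogeneous (hm : 1 ≤ m)
    (hw : ∀ l ω s, l < t → 1 ≤ ω → ω ≤ d →
      IsWeightedHomogeneous w (∏ j : Fin m, (op l ω s j).eval V) ω)
    (x y : Fin (d + 1) × Fin (t + 1)) (s : Fin S) :
    IsWeightedHomogeneous w (∏ j : Fin m, (jumpOp d t S m op x y s j).eval V) ((y.1 : ℕ) - x.1) := by
  unfold jumpOp
  have hy1 := y.1.isLt
  have hy2 := y.2.isLt
  by_cases hv : (x.2 : ℕ) < y.2 ∧ (x.1 : ℕ) < y.1
  · simp only [if_pos hv]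
    exact hw _ _ s (by omega) (by omega) (by omega)
  · simp only [if_neg hv]
    rw [Finset.prod_eq_zero (Finset.mem_univ (⟨0, hm⟩ : Fin m)) (by simp only [Operand.eval, C_0])]
    exact isWeightedHomogeneous_zero k w _

/-- Rows of the presented identity entry have weight `y₁ - x₁` (needs `1 ≤ m`). -/
theorem prod_idOp_isWeightedHomogeneous (hm : 1 ≤ m) (x y : Fin (d + 1) × Fin (t + 1)) (s : Fin S) :
    IsWeightedHomogeneous w (∏ j : Fin m, (idOp d t S m x y s j : Operand k τ).eval V)
      ((y.1 : ℕ) - x.1) := by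
  unfold idOp
  by_cases h : x = y ∧ (s : ℕ) = 0
  · simp only [if_pos h]
    rw [← h.1, Nat.sub_self, Finset.prod_eq_one (fun j _ => by simp only [Operand.eval, C_1])]
    exact isWeightedHomogeneous_one k w
  · simp only [if_neg h]
    rw [Finset.prod_eq_zero (Finset.mem_univ (⟨0, hm⟩ : Fin m)) (by simp only [Operand.eval, C_0])]
    exact isWeightedHomogeneous_zero k w _

/-- Rows of the presented padded layers have weight `y₁ - x₁`. -/
theorem prod_layerOp_isWeightedHomogeneous (hm : 1 ≤ m)
    (hw : ∀ l ω s, l < t → 1 ≤ ω → ω ≤ d →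
      IsWeightedHomogeneous w (∏ j : Fin m, (op l ω s j).eval V) ω)
    (κ i : ℕ) (x y : Fin (d + 1) × Fin (t + 1)) (s : Fin S) :
    IsWeightedHomogeneous w (∏ j : Fin m, (layerOp d t S m op κ i x y s j).eval V)
      ((y.1 : ℕ) - x.1) := by
  unfold layerOp
  by_cases hi : i < κ
  · simp only [if_pos hi]; exact prod_jumpOp_isWeightedHomogeneous w d t S m op V hm hw x y s
  · simp only [if_neg hi]; exact prod_idOp_isWeightedHomogeneous w d t S m V hm x y s

/-- References of the presented layer operands. -/
theorem layerOp_refsBelow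
    (hrefs : ∀ l ω s j, l < t → 1 ≤ ω → ω ≤ d → (op l ω s j).RefsBelow n)
    (κ i : ℕ) (x y : Fin (d + 1) × Fin (t + 1)) (s : Fin S) (j : Fin m) :
    (layerOp d t S m op κ i x y s j).RefsBelow n := by
  unfold layerOp jumpOp idOp
  have hy1 := y.1.isLt
  have hy2 := y.2.isLt
  by_cases hi : i < κ
  · simp only [if_pos hi]
    by_cases hv : (x.2 : ℕ) < y.2 ∧ (x.1 : ℕ) < y.1
    · simp only [if_pos hv]; exact hrefs _ _ s j (by omega) (by omega) (by omega)
    · simp only [if_neg hv]; trivial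
  · simp only [if_neg hi]
    by_cases h : x = y ∧ (s : ℕ) = 0
    · simp only [if_pos h]; trivial
    · simp only [if_neg h]; trivial

/-- Depth of the presented layer operands. -/
theorem layerOp_depthIn
    (hdp : ∀ l ω s j, l < t → 1 ≤ ω → ω ≤ d → (op l ω s j).depthIn D ≤ D₀)
    (κ i : ℕ) (x y : Fin (d + 1) × Fin (t + 1)) (s : Fin S) (j : Fin m) :
    (layerOp d t S m op κ i x y s j).depthIn D ≤ D₀ := by
  unfold layerOp jumpOp idOp
  have hy1 := y.1.isLt
  have hy2 := y.2.isLt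
  by_cases hi : i < κ
  · simp only [if_pos hi]
    by_cases hv : (x.2 : ℕ) < y.2 ∧ (x.1 : ℕ) < y.1
    · simp only [if_pos hv]; exact hdp _ _ s j (by omega) (by omega) (by omega)
    · simp only [if_neg hv]; exact Nat.zero_le _
  · simp only [if_neg hi]
    by_cases h : x = y ∧ (s : ℕ) = 0
    · simp only [if_pos h]; exact Nat.zero_le _
    · simp only [if_neg h]; exact Nat.zero_le _

end Present

end Summit.ValiantsHypothesis.ValiantsHypothesis.Theorems.DepthWindow

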